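import Mathlib
import HarnessLib
import Summits.HubbardSuperconductivity.HubbardSuperconductivity.Theorems.KLProgrammeKLRegimeSplitModelCongr
import Summits.HubbardSuperconductivity.HubbardSuperconductivity.Theorems.KLProgrammeKLRegimeSplitCounterMap

/-!
# Route `KLProgramme`, crux K3 — Δ23, the (R-I-min) ADAPTER KIT: `TrigPolyC4v` frames entering the function-carrier two-leg texts as `K.eval`

Cell gate-hubbard-kl, seat p2 (g6); continues `…KLRegimeSplitFrameFn` / `…FrameFnLemmas` / `…ModelCongr`.  Under (R-I-min) (plan g11 Δ23 (H);
plan2 g3 GEN5-INVENTORY §1–2) frames STAY `K : TrigPolyC4v` with today's class `FrameOK` and distance `frameDist`, only the two-leg PIECES become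
functions.  This file provides exactly what a bundle `klPredsV13 : Preds` (twoLeg := a slot over Fn pieces, the four other slots = V12's) needs to
quote the LANDED Fn clause texts at `K.eval` without any bridge obligation:

* §1 `frameLevelFn μ K.eval = frameLevel μ K`, `onM A.eval = evalM A` (rfl-level), **`frameOKFn_eval_of_frameOK : FrameOK R U N μ K → FrameOKFn R U N μ K.eval`**
  (a `TrigPolyC4v` frame admissible today is admissible as a function: its pieces' `eval`s are symmetric, `C^∞`, with the same bounds) —
  so the tier-2 guard `FrameOKFn R U n μ K.eval →` of `TwoLegSizesFn … K.eval n` is DISCHARGED by today's guard, and `frameDistFn K.eval K'.eval =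
  frameDist K K'` (rfl);
* §2 the ONE thin variant (R-I-min) needs: **`FrameLipschitzFnT hist … (K : TrigPolyC4v) n`** — the (E3c) text on Fn pieces with the comparison
  frame ranging over today's admissible `TrigPolyC4v` class and today's `hist : TrigPolyC4v → ℕ → Prop` / `frameDist` (the landed `FrameLipschitzFn`
  ranges over admissible FUNCTIONS with a function-valued history — the (R-I) shape), and the slot text **`TwoLegStepT hist … K n :=
  TwoLegSizesFn … K.eval n ∧ TwoLegFloorFn … K.eval n ∧ FrameLipschitzFnT hist … K n ∧ TwoLegSlopes … K n`** (slopes = today's, by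
  `twoLegSlopesFn_eval_iff`), `TwoLegSizesMST … K n := TwoLegSizesMSFn … K.eval n`; (E3g) `TwoLegAngularG` and (E3f) `TwoLegVolumeRate` are
  today's VERBATIM under (R-I-min) (they read (I-1) `klLocalPart` values/derivatives only);
* §3 bookkeeping: `TwoLegFloorFn … K.eval` reads `frameLevel μ K` (rfl), the tier-1 sizes of `TwoLegStepT` in the `evalM`-free form consumers cite.

Definitions (2 slot texts + 2 abbreviations) + lemmas; nothing is asserted about the model.  (R-I) consumers ignore this file.
-/

noncomputable section

namespace Summit.HubbardSuperconductivity.HubbardSuperconductivity.Theorems.KLRegimeSplit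

set_option linter.dupNamespace false -- summit = problem name (single-conjunct summit), D-0017

open scoped InnerProductSpace
open Real Finset Literature.MathematicalPhysics.QuantumLattice Literature.Probability.LatticeModels
open Literature.MathematicalPhysics.QuantumLattice.FermiRG
open Summit.HubbardSuperconductivity.HubbardSuperconductivity.Theorems.KLProgrammeLegKernels
open Summit.HubbardSuperconductivity.HubbardSuperconductivity.Theorems.DispersionFlow

/-! ## §1 `TrigPolyC4v` frames as functions: the admissible class and the distance agree -/

/-- The renormalised band of a `TrigPolyC4v` frame read as a function is today's `frameLevel`. -/
theorem frameLevelFn_eval (μ : ℝ) (K : TrigPolyC4v) : frameLevelFn μ K.eval = frameLevel μ K := rfl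

/-- `onM K.eval = evalM K`. -/
theorem onM_eval (K : TrigPolyC4v) : onM K.eval = evalM K := rfl

/-- `frameDistFn` of two `TrigPolyC4v` frames read as functions is today's `frameDist`. -/
theorem frameDistFn_eval (K K' : TrigPolyC4v) : frameDistFn K.eval K'.eval = frameDist K K' := rfl

/-- **Today's admissible frames are admissible as functions**: `FrameOK R U N μ K → FrameOKFn R U N μ K.eval` (the pieces' `eval`s are
symmetric frames, `C⁴`, with the same two-tier bounds).  Discharges the tier-2 guard of `TwoLegSizesFn … K.eval n` from today's guard. -/
theorem frameOKFn_eval_of_frameOK {R : RenConsts} {U : ℝ} {N : ℕ} {μ : ℝ} {K : TrigPolyC4v} (h : FrameOK R U N μ K) :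
    FrameOKFn R U N μ K.eval := by
  obtain ⟨hgeom, Kp, hsum, hbd⟩ := h
  refine ⟨isSymmetricFrame_eval K, hgeom, fun n => (Kp n).eval, hsum, fun n hn => ⟨isSymmetricFrame_eval (Kp n), ?_, ?_⟩⟩
  · exact contDiff_evalM (Kp n)
  · intro j hj q
    exact hbd n hn j hj q

section Model

variable (L M : ℕ) [NeZero L] [NeZero M]

/-! ## §2 The (R-I-min) two-leg clause texts -/

/-- **(E3c-T)** the frame-Lipschitz bound of the FUNCTION piece, (R-I-min) shape: the comparison frame ranges over today's admissible
`TrigPolyC4v` class with today's history `hist` and today's `frameDist`: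
`∀ K' admissible, hist K' below n ⇒ sup_q |ℓ_n^{Fn}(K.eval)(q) − ℓ_n^{Fn}(K'.eval)(q)| ≤ lipBar n · frameDist K K'`. -/
def FrameLipschitzFnT (hist : TrigPolyC4v → ℕ → Prop) (G : GeoConsts) (Q : EngConsts) (R : RenConsts) (β U μ : ℝ)
    (K : TrigPolyC4v) (n : ℕ) : Prop :=
  ∀ K' : TrigPolyC4v, FrameOK R U (klTempScaleIdx β klE0) μ K' → (∀ j < n, hist K' j) →
    ∀ q : Fin 2 → ℝ,
      |klTwoLegPieceFn L M β U μ K.eval n q - klTwoLegPieceFn L M β U μ K'.eval n q| ≤ lipBar G Q U n * frameDist K K'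

/-- **(E3a-MS-T)** the multi-slot sizes of the function piece of a `TrigPolyC4v` frame (the landed Fn text at `K.eval`). -/
abbrev TwoLegSizesMST (G : GeoConsts) (Q : EngConsts) (R : RenConsts) (β U μ : ℝ) (K : TrigPolyC4v) (n : ℕ) : Prop :=
  TwoLegSizesMSFn L M G Q R β U μ K.eval n

/-- **`TwoLegStepT hist … K n`** — the (R-I-min) two-leg step: (E3a) sizes and (E3b) floor of the FUNCTION piece (landed Fn texts at `K.eval`),
(E3c-T) frame-Lipschitz over today's class, and today's (E3d/e) `TwoLegSlopes` (unchanged: it reads (I-1) values; `twoLegSlopesFn_eval_iff`). -/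
def TwoLegStepT (hist : TrigPolyC4v → ℕ → Prop) (G : GeoConsts) (_P : SplitConsts) (Q : EngConsts) (R : RenConsts)
    (β U μ : ℝ) (K : TrigPolyC4v) (n : ℕ) : Prop :=
  TwoLegSizesFn L M G Q R β U μ K.eval n ∧ TwoLegFloorFn L M G Q β U μ K.eval n ∧
    FrameLipschitzFnT L M hist G Q R β U μ K n ∧ TwoLegSlopes L M R β U μ K n

/-! ## §3 Bookkeeping the consumers cite -/

variable {L M}

/-- The four conjuncts of `TwoLegStepT`. -/
theorem TwoLegStepT.sizes {hist : TrigPolyC4v → ℕ → Prop} {G : GeoConsts} {P : SplitConsts} {Q : EngConsts} {R : RenConsts}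
    {β U μ : ℝ} {K : TrigPolyC4v} {n : ℕ} (h : TwoLegStepT L M hist G P Q R β U μ K n) :
    TwoLegSizesFn L M G Q R β U μ K.eval n := h.1

/-- The floor conjunct. -/
theorem TwoLegStepT.floor {hist : TrigPolyC4v → ℕ → Prop} {G : GeoConsts} {P : SplitConsts} {Q : EngConsts} {R : RenConsts}
    {β U μ : ℝ} {K : TrigPolyC4v} {n : ℕ} (h : TwoLegStepT L M hist G P Q R β U μ K n) :
    TwoLegFloorFn L M G Q β U μ K.eval n := h.2.1

/-- The Lipschitz conjunct. -/
theorem TwoLegStepT.lipschitz {hist : TrigPolyC4v → ℕ → Prop} {G : GeoConsts} {P : SplitConsts} {Q : EngConsts} {R : RenConsts}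
    {β U μ : ℝ} {K : TrigPolyC4v} {n : ℕ} (h : TwoLegStepT L M hist G P Q R β U μ K n) :
    FrameLipschitzFnT L M hist G Q R β U μ K n := h.2.2.1

/-- The slopes conjunct (today's text). -/
theorem TwoLegStepT.slopes {hist : TrigPolyC4v → ℕ → Prop} {G : GeoConsts} {P : SplitConsts} {Q : EngConsts} {R : RenConsts}
    {β U μ : ℝ} {K : TrigPolyC4v} {n : ℕ} (h : TwoLegStepT L M hist G P Q R β U μ K n) :
    TwoLegSlopes L M R β U μ K n := h.2.2.2

/-- **Tier 2 from today's guard**: under `TwoLegStepT`, a frame admissible at level `n` TODAY (`FrameOK R U n μ K`) has all four derivative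
bounds `j ≤ 4` of its function piece. -/
theorem TwoLegStepT.norm_iteratedFDeriv_le_of_frameOK {hist : TrigPolyC4v → ℕ → Prop} {G : GeoConsts} {P : SplitConsts}
    {Q : EngConsts} {R : RenConsts} {β U μ : ℝ} {K : TrigPolyC4v} {n : ℕ} (h : TwoLegStepT L M hist G P Q R β U μ K n)
    (hK : FrameOK R U n μ K) {j : ℕ} (hj : j ≤ 4) (q : Momentum) :
    ‖iteratedFDeriv ℝ j (onM (klTwoLegPieceFn L M β U μ K.eval n)) q‖ ≤ twoLegBar G Q U j n :=
  h.1.2.2 (frameOKFn_eval_of_frameOK hK) j hj q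

/-- Tier 1 (`j ≤ 2`) for every admissible frame, no guard. -/
theorem TwoLegStepT.norm_iteratedFDeriv_le {hist : TrigPolyC4v → ℕ → Prop} {G : GeoConsts} {P : SplitConsts}
    {Q : EngConsts} {R : RenConsts} {β U μ : ℝ} {K : TrigPolyC4v} {n : ℕ} (h : TwoLegStepT L M hist G P Q R β U μ K n)
    {j : ℕ} (hj : j ≤ 2) (q : Momentum) :
    ‖iteratedFDeriv ℝ j (onM (klTwoLegPieceFn L M β U μ K.eval n)) q‖ ≤ twoLegBar G Q U j n :=
  h.1.2.1 j hj q

/-- The floor clause of the function piece reads today's band `frameLevel μ K` (so p4's tube geometry applies verbatim). -/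
theorem TwoLegStepT.floor_apply {hist : TrigPolyC4v → ℕ → Prop} {G : GeoConsts} {P : SplitConsts} {Q : EngConsts} {R : RenConsts}
    {β U μ : ℝ} {K : TrigPolyC4v} {n : ℕ} (h : TwoLegStepT L M hist G P Q R β U μ K n) (p : Momentum)
    (hp : |frameLevel μ K p| < 3 / 80) (t : Momentum) (ht : inner ℝ (gradient (frameLevel μ K) p) t = 0) :
    -(bflBar G Q U n) * ‖t‖ ^ 2 ≤ hessQuad (onM (klTwoLegPieceFn L M β U μ K.eval n)) p t :=
  h.2.1 p hp t ht

/-- The (E3d/e) slopes of `TwoLegStepT` in the Fn spelling (same statement, `twoLegSlopesFn_eval_iff`). -/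
theorem TwoLegStepT.slopesFn {hist : TrigPolyC4v → ℕ → Prop} {G : GeoConsts} {P : SplitConsts} {Q : EngConsts} {R : RenConsts}
    {β U μ : ℝ} {K : TrigPolyC4v} {n : ℕ} (h : TwoLegStepT L M hist G P Q R β U μ K n) :
    TwoLegSlopesFn L M R β U μ K.eval n :=
  (twoLegSlopesFn_eval_iff L M R β U μ K n).mpr h.2.2.2

end Model

end Summit.HubbardSuperconductivity.HubbardSuperconductivity.Theorems.KLRegimeSplit

end
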